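import Literature.Geometry.Kaehler.ComplexTorusAnalyticClasses
import Literature.Geometry.Kaehler.ComplexTorusSemipositiveConeEffective
import Literature.Geometry.Kaehler.ComplexTorusMaximalAbelianQuotient
import HarnessLib

/-!
# `A¹(X)` of an arbitrary complex torus: the analytic divisor classes are spanned by the semi-positive
# Néron–Severi classes; `X_a = 0 ⇒ A¹(X) = 0`

Rider to row A4-104 (`ComplexTorusAnalyticClasses.lean`: `analyticClasses Φ e p = Aᵖ(X)`, Voisin's
`Hdg^{2k}(X)_{an}`, Lange's algebraic classes) of lane `lit-hodgefound`. For an ABELIAN VARIETY `A¹ = B¹ = NS ⊗ ℚ`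
(Lefschetz `(1,1)` in cycle form, `IsAbelianVariety.analyticClasses_one_eq_hodgeClasses`). For an ARBITRARY
complex torus `X = E/Λ` the analytic divisor classes are a possibly proper subspace of `B¹(X)`, described by
Lange's Theorem 1.5.11 / Exercise 2.1.6 (8), (10) ("the semi-positive cone is the effective cone", skel-2's
`ComplexTorus.semipos_iff_exists_sum_analyticCycleClass_eq`, `ComplexTorusSemipositiveConeEffective.lean`):

* §1 `ofRealForm_neg_mem_analyticClassesInt_of_isSemiposNSForm` — for every positive semidefinite
  `η ∈ NS(X)` (`IsSemiposNSForm Φ η`: `H_η ≥ 0`) the class `ofRealForm (-η)` is a sum of classes of analytic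
  hypersurfaces, hence lies in `A¹(X)_ℤ` (any enumeration `e` of the lattice basis); and conversely
  `exists_isSemiposNSForm_of_mem_analyticCycleClassSet` (the class of a hypersurface is `ofRealForm (-η)` with
  `η` semi-positive, up to the orientation sign of `e`).
* §2 **`analyticClassesInt_one_eq_closure_semipos`**, **`analyticClasses_one_eq_span_semipos`**:
  `A¹(X)_ℤ` (resp. `A¹(X)`) is the subgroup (resp. `ℚ`-subspace) of `H²(X)` generated by
  `{ofRealForm (-η) : η ∈ NS(X), H_η ≥ 0}` — THE ANALYTIC DIVISOR CLASSES OF ANY COMPLEX TORUS ARE SPANNED BY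
  ITS SEMI-POSITIVE NÉRON–SEVERI CLASSES (the effective cone).
* §3 `eq_zero_of_nsRadical_eq_top` (`Λ(L)⁰ = V ⇒ E_L = 0`), `IsSemiposNSForm.eq_zero_of_abelianRadical_eq_top`
  and **`analyticClasses_one_eq_bot_of_abelianRadical_eq_top`**: a complex torus with `X_a = 0`
  (`Λ(L_a)⁰ = Λ ⊗ ℝ`, e.g. `NS(X) = 0` or a simple non-algebraic torus) has `A¹(X) = 0` — Lange's Exercise
  2.1.6 (8)(g) "a torus with `X_a = 0` carries no analytic hypersurface" in the language of analytic classes.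

Theorems only; no definition, no named fact.

## References

* [Lange2023AbelianVarietiesComplex] H. Lange, Abelian Varieties over the Complex Numbers (2023), §1.5.4
  Thm. 1.5.11 and (1.22); §2.1.1 (p. 78); §2.1.6 Exercise (8)(b),(g) and Exercise (10) (p. 88); §6.2.1 (p. 300).
* [VoisinHodgeI2002] C. Voisin, Hodge Theory and Complex Algebraic Geometry I (2002), §11.3.1
  (`Hdg^{2k}(X)_{an}`), Thm. 11.33.
-/

noncomputable section

open scoped Manifold
open Complex Module Set Function

universe u

namespace Literature.Geometry.Kaehler

namespace ComplexTorus

section Semipositive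

variable {ι : Type*} [Fintype ι] [DecidableEq ι] {E : Type u} [NormedAddCommGroup E] [InnerProductSpace ℂ E]
  [FiniteDimensional ℂ E] [MeasurableSpace E] [BorelSpace E] (Φ : (ι → ℝ) ≃L[ℝ] E) {n d : ℕ}
  (e : Fin n ≃ ι) (h : 2 * d + 2 = n)

/-! ### §1 Semi-positive classes are analytic classes -/

include h in
/-- **A semi-positive Néron–Severi class is an analytic class**: for `η ∈ NS(X)` with `H_η ≥ 0` the class
`ofRealForm (-η)` is a finite sum `Σ [Yᵢ]` of fundamental classes of analytic hypersurfaces (Lange's Theorem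
1.5.11 / the semi-positive cone is the effective cone), hence lies in `A¹(X)_ℤ` — for every enumeration `e` of
the lattice basis (`A¹(X)_ℤ` does not depend on `e`).
[cite: Lange2023AbelianVarietiesComplex, §1.5.4 Thm. 1.5.11 and §2.1.1 (p. 78)] [cite: VoisinHodgeI2002, §11.3.1 Thm. 11.33] -/
theorem ofRealForm_neg_mem_analyticClassesInt_of_isSemiposNSForm {η : E [⋀^Fin 2]→L[ℝ] ℝ}
    (hη : IsSemiposNSForm Φ η) : ofRealForm (-η) ∈ analyticClassesInt Φ e 1 := by
  obtain ⟨e', he'⟩ := exists_orientationSign_eq_one Φ e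
  rw [← analyticClassesInt_eq_analyticClassesInt Φ e e']
  obtain ⟨k, Y, hsum⟩ := exists_sum_analyticCycleClass_eq_of_semipos Φ e' h he' hη.toIsNSForm hη.semipos
  rw [hsum]
  exact AddSubgroup.sum_mem _ fun i _ ↦ analyticCycleClass_mem_analyticClassesInt Φ e' h (Y i).2

include h in
/-- `ℚ`-version: `ofRealForm (-η) ∈ A¹(X)` for every semi-positive `η ∈ NS(X)`.
[cite: Lange2023AbelianVarietiesComplex, §1.5.4 Thm. 1.5.11 and §2.1.1 (p. 78)] [cite: VoisinHodgeI2002, §11.3.1 Thm. 11.33] -/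
theorem ofRealForm_neg_mem_analyticClasses_of_isSemiposNSForm {η : E [⋀^Fin 2]→L[ℝ] ℝ}
    (hη : IsSemiposNSForm Φ η) : ofRealForm (-η) ∈ analyticClasses Φ e 1 :=
  analyticClassesInt_le_toAddSubgroup Φ e (ofRealForm_neg_mem_analyticClassesInt_of_isSemiposNSForm Φ e h hη)

include h in
/-- **Conversely, the class of an analytic hypersurface is `ofRealForm (-η)` for a semi-positive `η ∈ NS(X)`**,
for a positively oriented enumeration `e` (Lange §2.1.6 Exercise (8): "`𝒪_X(D)` is positive semidefinite").
[cite: Lange2023AbelianVarietiesComplex, §1.5.4 (p. 58) and §2.1.6 Exercise (8) (p. 88)] -/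
theorem exists_isSemiposNSForm_analyticCycleClass_eq (he : orientationSign Φ e = 1) {Z : Set (ComplexTorus Φ)}
    (hZ : HasPureDim 𝓘(ℂ, E) Z d) :
    ∃ η : E [⋀^Fin 2]→L[ℝ] ℝ, IsSemiposNSForm Φ η ∧ analyticCycleClass Φ e h hZ = ofRealForm (-η) := by
  -- the class is an integral `(1,1)`-class, hence `ofRealForm η₀` for some `η₀ ∈ NS(X)`
  have hmem : analyticCycleClass Φ e h hZ ∈ (integralHodgeClasses Φ 1 : Set (E [⋀^Fin (2 * 1)]→L[ℝ] ℂ)) :=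
    analyticCycleClass_mem_integralHodgeClasses_unconditional Φ e h hZ
  rw [coe_integralHodgeClasses_one_eq_image] at hmem
  obtain ⟨η₀, -, hη₀⟩ := hmem
  refine ⟨-η₀, ?_, by rw [neg_neg]; exact hη₀.symm⟩
  -- semi-positivity: the effective cone lies in the semi-positive cone
  have hsum : ofRealForm (-(-η₀)) = ∑ i : Fin 1, analyticCycleClass Φ e h
      ((fun _ ↦ (⟨Z, hZ⟩ : {Z : Set (ComplexTorus Φ) // HasPureDim 𝓘(ℂ, E) Z d})) i).2 := by
    rw [neg_neg, Finset.sum_const, Finset.card_univ, Fintype.card_fin, one_smul]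
    exact hη₀
  obtain ⟨hNS, hpos⟩ := (semipos_iff_exists_sum_analyticCycleClass_eq Φ e h he (-η₀)).2 ⟨1, _, hsum⟩
  exact ⟨hNS, hpos⟩

include h in
/-- Every element of the generating set of `A¹(X)_ℤ` is `ofRealForm (-η)` with `η` semi-positive (positively
oriented `e`). [cite: Lange2023AbelianVarietiesComplex, §1.5.4 (p. 58) and §2.1.6 Exercise (8) (p. 88)] -/
theorem exists_isSemiposNSForm_of_mem_analyticCycleClassSet (he : orientationSign Φ e = 1)
    {γ : E [⋀^Fin (2 * 1)]→L[ℝ] ℂ} (hγ : γ ∈ analyticCycleClassSet Φ e 1) :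
    ∃ η : E [⋀^Fin 2]→L[ℝ] ℝ, IsSemiposNSForm Φ η ∧ γ = ofRealForm (-η) := by
  rw [analyticCycleClassSet_eq Φ e (d := d) (p := 1) h] at hγ
  obtain ⟨Z, hZ, rfl⟩ := hγ
  exact exists_isSemiposNSForm_analyticCycleClass_eq Φ e h he hZ

/-! ### §2 `A¹(X)` is generated by the semi-positive Néron–Severi classes -/

include h in
/-- **`A¹(X)_ℤ` IS THE SUBGROUP GENERATED BY THE SEMI-POSITIVE NÉRON–SEVERI CLASSES** (the effective cone
of `NS(X)`): `A¹(X)_ℤ = ⟨ofRealForm (-η) : η ∈ NS(X), H_η ≥ 0⟩` for every complex torus `X = E/Λ`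
(`rk Λ = 2d + 2`) and every enumeration `e`.
[cite: Lange2023AbelianVarietiesComplex, §1.5.4 Thm. 1.5.11, §2.1.1 (p. 78) and §2.1.6 Exercise (10) (p. 88)] [cite: VoisinHodgeI2002, §11.3.1] -/
theorem analyticClassesInt_one_eq_closure_semipos :
    analyticClassesInt Φ e 1 =
      AddSubgroup.closure {γ | ∃ η : E [⋀^Fin 2]→L[ℝ] ℝ, IsSemiposNSForm Φ η ∧ γ = ofRealForm (-η)} := by
  obtain ⟨e', he'⟩ := exists_orientationSign_eq_one Φ e
  rw [← analyticClassesInt_eq_analyticClassesInt Φ e e']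
  refine le_antisymm ((AddSubgroup.closure_le _).2 fun γ hγ ↦ ?_) ((AddSubgroup.closure_le _).2 ?_)
  · obtain ⟨η, hη, rfl⟩ := exists_isSemiposNSForm_of_mem_analyticCycleClassSet Φ e' h he' hγ
    exact AddSubgroup.subset_closure ⟨η, hη, rfl⟩
  · rintro γ ⟨η, hη, rfl⟩
    exact ofRealForm_neg_mem_analyticClassesInt_of_isSemiposNSForm Φ e' h hη

include h in
/-- **`A¹(X)` IS THE `ℚ`-SPAN OF THE SEMI-POSITIVE NÉRON–SEVERI CLASSES**: the analytic (algebraic) divisor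
classes of an arbitrary complex torus are `span_ℚ {ofRealForm (-η) : η ∈ NS(X), H_η ≥ 0}` — a subspace of
`B¹(X) = NS(X) ⊗ ℚ` which is all of it for abelian varieties (every class is a difference of ample ones) and
can be `0 ≠ B¹(X)` otherwise (Zucker's torus, `Zucker.analyticClasses_one_ne_hodgeClasses`).
[cite: Lange2023AbelianVarietiesComplex, §1.5.4 Thm. 1.5.11, §2.1.1 (p. 78) and §2.1.6 Exercise (10) (p. 88)] [cite: VoisinHodgeI2002, §11.3.1] -/
theorem analyticClasses_one_eq_span_semipos :
    analyticClasses Φ e 1 =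
      Submodule.span ℚ {γ | ∃ η : E [⋀^Fin 2]→L[ℝ] ℝ, IsSemiposNSForm Φ η ∧ γ = ofRealForm (-η)} := by
  obtain ⟨e', he'⟩ := exists_orientationSign_eq_one Φ e
  rw [← analyticClasses_eq_analyticClasses Φ e e']
  refine le_antisymm (Submodule.span_le.2 fun γ hγ ↦ ?_) (Submodule.span_le.2 ?_)
  · obtain ⟨η, hη, rfl⟩ := exists_isSemiposNSForm_of_mem_analyticCycleClassSet Φ e' h he' hγ
    exact Submodule.subset_span ⟨η, hη, rfl⟩
  · rintro γ ⟨η, hη, rfl⟩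
    exact ofRealForm_neg_mem_analyticClasses_of_isSemiposNSForm Φ e' h hη

include h in
/-- If the only semi-positive element of `NS(X)` is `0`, then `A¹(X) = 0` (no analytic hypersurface; compare
`not_hasPureDim_hypersurface_of_forall_semipos_eq_zero`). [cite: Lange2023AbelianVarietiesComplex, §2.1.6 Exercise (8)(g), p. 88] -/
theorem analyticClasses_one_eq_bot_of_forall_isSemiposNSForm_eq_zero
    (h0 : ∀ η : E [⋀^Fin 2]→L[ℝ] ℝ, IsSemiposNSForm Φ η → η = 0) : analyticClasses Φ e 1 = ⊥ := by
  rw [analyticClasses_one_eq_span_semipos Φ e h, Submodule.span_eq_bot]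
  rintro γ ⟨η, hη, rfl⟩
  rw [h0 η hη, neg_zero]
  ext v
  rw [ofRealForm_apply, ContinuousAlternatingMap.coe_zero, ContinuousAlternatingMap.coe_zero, Pi.zero_apply,
    Pi.zero_apply, ofReal_zero]

/-! ### §3 `X_a = 0 ⇒ A¹(X) = 0` -/

omit [Fintype ι] [DecidableEq ι] [InnerProductSpace ℂ E] [FiniteDimensional ℂ E] [MeasurableSpace E] [BorelSpace E] in
/-- A real `2`-form whose radical `Λ(L)⁰` is everything vanishes (`H(v, V) = 0` for all `v`).
[cite: Lange2023AbelianVarietiesComplex, §1.5.4 (1.22), p. 58] -/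
theorem eq_zero_of_nsRadical_eq_top [NormedSpace ℂ E] (Φ : (ι → ℝ) ≃L[ℝ] E) {η : E [⋀^Fin 2]→L[ℝ] ℝ}
    (hη : nsRadical Φ η = ⊤) : η = 0 := by
  ext v
  have h0 : η ![v 0, v 1] = 0 := by
    obtain ⟨x, hx⟩ := Φ.surjective (v 0)
    have hx' : x ∈ nsRadical Φ η := by rw [hη]; exact Submodule.mem_top
    rw [← hx]
    exact (mem_nsRadical_iff_forall Φ η).1 hx' (v 1)
  have hv : v = ![v 0, v 1] := by funext i; fin_cases i <;> rfl
  rw [hv, h0, ContinuousAlternatingMap.coe_zero, Pi.zero_apply]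

omit [Fintype ι] [DecidableEq ι] [InnerProductSpace ℂ E] [FiniteDimensional ℂ E] [MeasurableSpace E] [BorelSpace E] in
/-- **On a torus with `X_a = 0` every semi-positive Néron–Severi class vanishes**: `Λ(L_a)⁰ ⊆ Λ(L)⁰` for every
positive semidefinite `L` (Exercise (8)(b)), so `Λ(L)⁰ = Λ ⊗ ℝ` and `E_L = 0`.
[cite: Lange2023AbelianVarietiesComplex, §2.1.6 Exercise (8)(b),(g), p. 88] -/
theorem IsSemiposNSForm.eq_zero_of_abelianRadical_eq_top [NormedSpace ℂ E] {Φ : (ι → ℝ) ≃L[ℝ] E}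
    (ha : abelianRadical Φ = ⊤) {η : E [⋀^Fin 2]→L[ℝ] ℝ} (hη : IsSemiposNSForm Φ η) : η = 0 :=
  eq_zero_of_nsRadical_eq_top Φ (eq_top_iff.2 (ha ▸ abelianRadical_le hη))

include h in
/-- **`X_a = 0 ⇒ A¹(X) = 0`**: a complex torus whose maximal abelian quotient is trivial (`Λ(L_a)⁰ = Λ ⊗ ℝ`;
e.g. `NS(X) = 0`, or a simple torus which is not an abelian variety, `abelianRadical_eq_top_of_isSimple`) has no
analytic divisor classes — "a torus with `X_a = 0` carries no analytic hypersurface".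
[cite: Lange2023AbelianVarietiesComplex, §2.1.6 Exercise (8)(g), p. 88] -/
theorem analyticClasses_one_eq_bot_of_abelianRadical_eq_top (ha : abelianRadical Φ = ⊤) :
    analyticClasses Φ e 1 = ⊥ :=
  analyticClasses_one_eq_bot_of_forall_isSemiposNSForm_eq_zero Φ e h fun _ hη ↦ hη.eq_zero_of_abelianRadical_eq_top ha

include h in
/-- Integral version: `X_a = 0 ⇒ A¹(X)_ℤ = 0`. [cite: Lange2023AbelianVarietiesComplex, §2.1.6 Exercise (8)(g), p. 88] -/
theorem analyticClassesInt_one_eq_bot_of_abelianRadical_eq_top (ha : abelianRadical Φ = ⊤) :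
    analyticClassesInt Φ e 1 = ⊥ := by
  rw [eq_bot_iff]
  intro γ hγ
  have hγ' : γ ∈ analyticClasses Φ e 1 := analyticClassesInt_le_toAddSubgroup Φ e hγ
  rw [analyticClasses_one_eq_bot_of_abelianRadical_eq_top Φ e h ha] at hγ'
  exact hγ'

include h in
/-- A simple complex torus which is not an abelian variety has `A¹(X) = 0`.
[cite: Lange2023AbelianVarietiesComplex, §2.1.6 Exercise (8)(g), p. 88] -/
theorem analyticClasses_one_eq_bot_of_isSimple (hs : IsSimple Φ) (hna : ¬ IsAbelianVariety Φ) :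
    analyticClasses Φ e 1 = ⊥ :=
  analyticClasses_one_eq_bot_of_abelianRadical_eq_top Φ e h (abelianRadical_eq_top_of_isSimple Φ hs hna)

end Semipositive

end ComplexTorus

end Literature.Geometry.Kaehler

end
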